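import Literature.Computability.MetaComplexity.BoundedArithTheories
import HarnessLib

/-!
# Models of `S₂ⁱ` / `T₂ⁱ`: the induction schemes in semantic form

Trunk: CplxMeta (G14), topic `Literature/Computability/MetaComplexity` (companion of
`BoundedArithTheories.lean`).  Infrastructure for arguing *inside an arbitrary model* of Buss's
theories, which is how "provable in `S₂ⁱ` / `T₂ⁱ`" (Mathlib's semantic `⊨ᵇ`) is established in
this library — in particular for the bootstrapping of `S₂¹` (Buss 1986, Ch. 2) on the way to
Buss's witnessing and conservation theorems
(`Literature/Computability/Complexity/BoundedArithmetic.lean`).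

* Names for the operations of an arbitrary `Language.boundedArith`-structure `M`:
  `mZero M`, `mSucc`, `mHalf`, `mLen`, `mAdd`, `mMul`, `mSmash`, `MLe`, with the `realize` lemmas
  for the term formers of `BoundedArithSyntax` (there stated for `ℕ` only) and for `Term.le`.
* `realize_indAxiom_iff`, `realize_pindAxiom_iff`, `realize_lindAxiom_iff`: what the axioms
  `IND(φ)`, `PIND(φ)`, `LIND(φ)` of `BoundedArithTheories` say in a structure.
* `ind_of_model_T2`, `pind_of_model_S2`: in a model of `T₂ⁱ` (`S₂ⁱ`), induction (polynomial
  induction) holds for every `Σᵇᵢ` formula with parameters; `induction_T2`, `pinduction_S2`: the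
  same for a predicate `P : M → Prop` known to be `Σᵇᵢ`-defined with parameters
  (Buss 1986, §2.3–2.4, Definitions of `S₂ⁱ`, `T₂ⁱ`).
* `model_BASIC_of_model_S2/T2`.

## References

* S. R. Buss, *Bounded Arithmetic*, Bibliopolis 1986, §§2.2–2.4.
* J. Krajíček, *Bounded Arithmetic, Propositional Logic and Complexity Theory*, CUP 1995,
  Def. 5.2.3.

## Design choices

* No instances (`Zero M`, `LE M`, …) are put on an arbitrary structure `M` (they would apply to
  every carrier of a `Language.boundedArith`-structure, e.g. `ℕ`, duplicating Mathlib's); plain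
  definitions `mZero`, …, `MLe` are used instead, with `rfl`-lemmas identifying them on `ℕ`.
* Structures live in `Type`, as in the `realize_…` lemmas of `BoundedArithTheories` and in
  Mathlib's `⊨ᵇ` for this language.
-/

namespace Literature.Computability.MetaComplexity

open FirstOrder FirstOrder.Language FirstOrder.Language.BoundedFormula

/-! ## The operations of a structure -/

section Operations

variable (M : Type*) [Language.boundedArith.Structure M]

/-- The interpretation of `0` in a structure `M` (Buss 1986, §2.2). [cite: Buss1986, §2.2] -/
def mZero : M := Structure.funMap (L := Language.boundedArith) BoundedArithFunc.zero default

variable {M}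

/-- The interpretation of the successor `S` in a structure `M` (Buss 1986, §2.2).
[cite: Buss1986, §2.2] -/
def mSucc (a : M) : M := Structure.funMap (L := Language.boundedArith) BoundedArithFunc.succ ![a]

/-- The interpretation of `⌊·/2⌋` in a structure `M` (Buss 1986, §2.2). [cite: Buss1986, §2.2] -/
def mHalf (a : M) : M := Structure.funMap (L := Language.boundedArith) BoundedArithFunc.half ![a]

/-- The interpretation of the length function `|·|` in a structure `M` (Buss 1986, §2.2).
[cite: Buss1986, §2.2] -/
def mLen (a : M) : M := Structure.funMap (L := Language.boundedArith) BoundedArithFunc.len ![a]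

/-- The interpretation of `+` in a structure `M` (Buss 1986, §2.2). [cite: Buss1986, §2.2] -/
def mAdd (a b : M) : M := Structure.funMap (L := Language.boundedArith) BoundedArithFunc.add ![a, b]

/-- The interpretation of `·` in a structure `M` (Buss 1986, §2.2). [cite: Buss1986, §2.2] -/
def mMul (a b : M) : M := Structure.funMap (L := Language.boundedArith) BoundedArithFunc.mul ![a, b]

/-- The interpretation of `#` in a structure `M` (Buss 1986, §2.2). [cite: Buss1986, §2.2] -/
def mSmash (a b : M) : M :=
  Structure.funMap (L := Language.boundedArith) BoundedArithFunc.smash ![a, b]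

/-- The interpretation of `≤` in a structure `M` (Buss 1986, §2.2). [cite: Buss1986, §2.2] -/
def MLe (a b : M) : Prop := Structure.RelMap (L := Language.boundedArith) BoundedArithRel.le ![a, b]

/-- `1 := S0` in a structure `M` (Buss 1986, §2.2). [cite: Buss1986, §2.2] -/
@[reducible] def mOne (M : Type*) [Language.boundedArith.Structure M] : M := mSucc (mZero M)

/-- `2 := S(S0)` in a structure `M` (Buss 1986, §2.2). [cite: Buss1986, §2.2] -/
@[reducible] def mTwo (M : Type*) [Language.boundedArith.Structure M] : M := mSucc (mOne M)

/-- On the standard model, `mZero ℕ = 0`. [folklore] -/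
@[simp] theorem mZero_nat : mZero ℕ = 0 := rfl
/-- On the standard model, `mSucc a = a + 1`. [folklore] -/
@[simp] theorem mSucc_nat (a : ℕ) : mSucc a = a + 1 := rfl
/-- On the standard model, `mHalf a = a / 2`. [folklore] -/
@[simp] theorem mHalf_nat (a : ℕ) : mHalf a = a / 2 := rfl
/-- On the standard model, `mLen a = Nat.size a`. [folklore] -/
@[simp] theorem mLen_nat (a : ℕ) : mLen a = Nat.size a := rfl
/-- On the standard model, `mAdd a b = a + b`. [folklore] -/
@[simp] theorem mAdd_nat (a b : ℕ) : mAdd a b = a + b := rfl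
/-- On the standard model, `mMul a b = a * b`. [folklore] -/
@[simp] theorem mMul_nat (a b : ℕ) : mMul a b = a * b := rfl
/-- On the standard model, `mSmash a b = 2 ^ (|a| * |b|)`. [folklore] -/
@[simp] theorem mSmash_nat (a b : ℕ) : mSmash a b = 2 ^ (Nat.size a * Nat.size b) := rfl
/-- On the standard model, `MLe a b ↔ a ≤ b`. [folklore] -/
@[simp] theorem mLe_nat (a b : ℕ) : MLe a b ↔ a ≤ b := Iff.rfl

variable {β : Type} (v : β → M) (t t₁ t₂ : Language.boundedArith.Term β)

/-- Semantics of the term `0` in a structure. [folklore] -/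
@[simp] theorem realize_term_zero : (0 : Language.boundedArith.Term β).realize v = mZero M := by
  change Structure.funMap _ _ = Structure.funMap _ _
  congr 1
  exact Subsingleton.elim _ _

/-- Semantics of `S t` in a structure. [folklore] -/
@[simp] theorem realize_term_succ : (Term.succ t).realize v = mSucc (t.realize v) :=
  Term.realize_functions_apply₁

/-- Semantics of `⌊t/2⌋` in a structure. [folklore] -/
@[simp] theorem realize_term_half : (Term.half t).realize v = mHalf (t.realize v) :=
  Term.realize_functions_apply₁

/-- Semantics of `|t|` in a structure. [folklore] -/
@[simp] theorem realize_term_len : (Term.len t).realize v = mLen (t.realize v) :=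
  Term.realize_functions_apply₁

/-- Semantics of `t₁ + t₂` in a structure. [folklore] -/
@[simp] theorem realize_term_add : (t₁ + t₂).realize v = mAdd (t₁.realize v) (t₂.realize v) :=
  Term.realize_functions_apply₂

/-- Semantics of `t₁ · t₂` in a structure. [folklore] -/
@[simp] theorem realize_term_mul : (t₁ * t₂).realize v = mMul (t₁.realize v) (t₂.realize v) :=
  Term.realize_functions_apply₂

/-- Semantics of `t₁ # t₂` in a structure. [folklore] -/
@[simp] theorem realize_term_smash :
    (Term.smash t₁ t₂).realize v = mSmash (t₁.realize v) (t₂.realize v) :=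
  Term.realize_functions_apply₂

/-- Semantics of the numeral `natConst k`: the `k`-fold successor of `0`. [folklore] -/
theorem realize_natConst' (k : ℕ) :
    (natConst k : Language.boundedArith.Term β).realize v = (mSucc^[k]) (mZero M) := by
  induction k with
  | zero => exact realize_term_zero v
  | succ k ih =>
    rw [natConst, realize_term_succ, ih, Function.iterate_succ_apply']


/-- Semantics of the numeral `1 = S0` in a structure. [folklore] -/
@[simp] theorem realize_natConst_one :
    (natConst 1 : Language.boundedArith.Term β).realize v = mSucc (mZero M) := by
  rw [realize_natConst']
  rfl

/-- Semantics of the numeral `2 = S(S0)` in a structure. [folklore] -/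
@[simp] theorem realize_natConst_two :
    (natConst 2 : Language.boundedArith.Term β).realize v = mSucc (mSucc (mZero M)) := by
  rw [realize_natConst']
  rfl

/-- Semantics of the atomic formula `t₁ ≤ t₂` in a structure (no `LE` instance needed; cf.
Mathlib's `Term.realize_le` for ordered structures). [folklore] -/
@[simp] theorem realize_le' {n : ℕ} (w : β → M) (xs : Fin n → M)
    (s₁ s₂ : Language.boundedArith.Term (β ⊕ Fin n)) :
    (Term.le s₁ s₂).Realize w xs ↔
      MLe (s₁.realize (Sum.elim w xs)) (s₂.realize (Sum.elim w xs)) := by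
  rw [Term.le, realize_rel₂]
  rfl

/-- Semantics of the bounded universal quantifier in a structure. [folklore] -/
@[simp] theorem realize_ballLE' {n : ℕ} (s : Language.boundedArith.Term (β ⊕ Fin n))
    (φ : Language.boundedArith.BoundedFormula β (n + 1)) (w : β → M) (xs : Fin n → M) :
    (ballLE s φ).Realize w xs ↔
      ∀ a, MLe a (s.realize (Sum.elim w xs)) → φ.Realize w (Fin.snoc xs a) := by
  simp [ballLE, Sum.elim_comp_map]

/-- Semantics of the bounded existential quantifier in a structure. [folklore] -/
@[simp] theorem realize_bexLE' {n : ℕ} (s : Language.boundedArith.Term (β ⊕ Fin n))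
    (φ : Language.boundedArith.BoundedFormula β (n + 1)) (w : β → M) (xs : Fin n → M) :
    (bexLE s φ).Realize w xs ↔
      ∃ a, MLe a (s.realize (Sum.elim w xs)) ∧ φ.Realize w (Fin.snoc xs a) := by
  simp [bexLE, Sum.elim_comp_map]

end Operations

/-! ## The induction axioms in a structure -/

section Axioms

variable {M : Type} [Language.boundedArith.Structure M] {k : ℕ}

/-- What the induction axiom `IND(φ)` says in a structure: for all parameters `p̄`, if
`φ(p̄, 0)` and `∀a (φ(p̄, a) → φ(p̄, S a))` then `∀a φ(p̄, a)` (Buss 1986, §2.3).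
[cite: Buss1986, §2.3] -/
theorem realize_indAxiom_iff (φ : Language.boundedArith.Formula (Fin (k + 1))) :
    M ⊨ indAxiom φ ↔ ∀ p : Fin k → M,
      φ.Realize (Fin.snoc p (mZero M)) →
        (∀ a, φ.Realize (Fin.snoc p a) → φ.Realize (Fin.snoc p (mSucc a))) →
          ∀ a, φ.Realize (Fin.snoc p a) := by
  rw [indAxiom, realize_closeFin]
  refine forall_congr' fun p => ?_
  simp only [Formula.realize_imp, Formula.realize_inf, realize_instLast, realize_allLast,
    realize_substLast, realize_term_zero, realize_term_succ, lastVar, Term.realize_var,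
    Fin.snoc_last, Fin.update_snoc_last, and_imp]

/-- What the polynomial induction axiom `PIND(φ)` says in a structure: for all parameters `p̄`,
if `φ(p̄, 0)` and `∀a (φ(p̄, ⌊a/2⌋) → φ(p̄, a))` then `∀a φ(p̄, a)` (Buss 1986, §2.3).
[cite: Buss1986, §2.3] -/
theorem realize_pindAxiom_iff (φ : Language.boundedArith.Formula (Fin (k + 1))) :
    M ⊨ pindAxiom φ ↔ ∀ p : Fin k → M,
      φ.Realize (Fin.snoc p (mZero M)) →
        (∀ a, φ.Realize (Fin.snoc p (mHalf a)) → φ.Realize (Fin.snoc p a)) →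
          ∀ a, φ.Realize (Fin.snoc p a) := by
  rw [pindAxiom, realize_closeFin]
  refine forall_congr' fun p => ?_
  simp only [Formula.realize_imp, Formula.realize_inf, realize_instLast, realize_allLast,
    realize_substLast, realize_term_zero, realize_term_half, lastVar, Term.realize_var,
    Fin.snoc_last, Fin.update_snoc_last, and_imp]

/-- What the length induction axiom `LIND(φ)` says in a structure: for all parameters `p̄`, if
`φ(p̄, 0)` and `∀a (φ(p̄, a) → φ(p̄, S a))` then `∀a φ(p̄, |a|)` (Buss 1986, §2.3).
[cite: Buss1986, §2.3] -/
theorem realize_lindAxiom_iff (φ : Language.boundedArith.Formula (Fin (k + 1))) :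
    M ⊨ lindAxiom φ ↔ ∀ p : Fin k → M,
      φ.Realize (Fin.snoc p (mZero M)) →
        (∀ a, φ.Realize (Fin.snoc p a) → φ.Realize (Fin.snoc p (mSucc a))) →
          ∀ a, φ.Realize (Fin.snoc p (mLen a)) := by
  rw [lindAxiom, realize_closeFin]
  refine forall_congr' fun p => ?_
  simp only [Formula.realize_imp, Formula.realize_inf, realize_instLast, realize_allLast,
    realize_substLast, realize_term_zero, realize_term_succ, realize_term_len, lastVar,
    Term.realize_var, Fin.snoc_last, Fin.update_snoc_last, and_imp]

end Axioms

/-! ## Induction in models of `T₂ⁱ` and `S₂ⁱ` -/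

section Models

variable {M : Type} [Language.boundedArith.Structure M] {i k : ℕ}

/-- A model of `S₂ⁱ` is a model of `BASIC` (Buss 1986, §2.4). [cite: Buss1986, §2.4] -/
theorem model_BASIC_of_model_S2 (h : M ⊨ S2 i) : M ⊨ BASIC :=
  h.mono (BASIC_subset_S2 i)

/-- A model of `T₂ⁱ` is a model of `BASIC` (Buss 1986, §2.4). [cite: Buss1986, §2.4] -/
theorem model_BASIC_of_model_T2 (h : M ⊨ T2 i) : M ⊨ BASIC :=
  h.mono (BASIC_subset_T2 i)

/-- The `IND` axiom of a `Σᵇᵢ` formula is an axiom of `T₂ⁱ` (Buss 1986, §2.4).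
[cite: Buss1986, §2.4] -/
theorem indAxiom_mem_T2 {φ : Language.boundedArith.Formula (Fin (k + 1))} (hφ : IsSigmab i φ) :
    indAxiom φ ∈ T2 i :=
  Or.inr (Set.mem_iUnion.2 ⟨k, Set.mem_image_of_mem _ hφ⟩)

/-- The `PIND` axiom of a `Σᵇᵢ` formula is an axiom of `S₂ⁱ` (Buss 1986, §2.4).
[cite: Buss1986, §2.4] -/
theorem pindAxiom_mem_S2 {φ : Language.boundedArith.Formula (Fin (k + 1))} (hφ : IsSigmab i φ) :
    pindAxiom φ ∈ S2 i :=
  Or.inr (Set.mem_iUnion.2 ⟨k, Set.mem_image_of_mem _ hφ⟩)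

/-- **Induction in models of `T₂ⁱ`.**  In a model of `T₂ⁱ`, ordinary induction on the last
variable holds for every `Σᵇᵢ` formula, uniformly in the parameters (Buss 1986, §2.4,
Definition of `T₂ⁱ`). [cite: Buss1986, §2.4] -/
theorem ind_of_model_T2 (hM : M ⊨ T2 i) {φ : Language.boundedArith.Formula (Fin (k + 1))}
    (hφ : IsSigmab i φ) (p : Fin k → M) (h0 : φ.Realize (Fin.snoc p (mZero M)))
    (hs : ∀ a, φ.Realize (Fin.snoc p a) → φ.Realize (Fin.snoc p (mSucc a))) (a : M) :
    φ.Realize (Fin.snoc p a) :=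
  (realize_indAxiom_iff φ).1 (hM.realize_of_mem _ (indAxiom_mem_T2 hφ)) p h0 hs a

/-- **Polynomial induction in models of `S₂ⁱ`.**  In a model of `S₂ⁱ`, polynomial induction
(`φ(⌊a/2⌋) → φ(a)`) on the last variable holds for every `Σᵇᵢ` formula, uniformly in the
parameters (Buss 1986, §2.4, Definition of `S₂ⁱ`). [cite: Buss1986, §2.4] -/
theorem pind_of_model_S2 (hM : M ⊨ S2 i) {φ : Language.boundedArith.Formula (Fin (k + 1))}
    (hφ : IsSigmab i φ) (p : Fin k → M) (h0 : φ.Realize (Fin.snoc p (mZero M)))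
    (hs : ∀ a, φ.Realize (Fin.snoc p (mHalf a)) → φ.Realize (Fin.snoc p a)) (a : M) :
    φ.Realize (Fin.snoc p a) :=
  (realize_pindAxiom_iff φ).1 (hM.realize_of_mem _ (pindAxiom_mem_S2 hφ)) p h0 hs a

/-- Induction in a model of `T₂ⁱ` for a predicate `P : M → Prop` which is defined, with
parameters `p̄ ∈ Mᵏ`, by a `Σᵇᵢ` formula `φ(p̄, x)` (Buss 1986, §2.4). [cite: Buss1986, §2.4] -/
theorem induction_T2 (hM : M ⊨ T2 i) {P : M → Prop}
    (φ : Language.boundedArith.Formula (Fin (k + 1))) (hφ : IsSigmab i φ) (p : Fin k → M)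
    (hP : ∀ a, P a ↔ φ.Realize (Fin.snoc p a)) (h0 : P (mZero M))
    (hs : ∀ a, P a → P (mSucc a)) (a : M) : P a :=
  (hP a).2 (ind_of_model_T2 hM hφ p ((hP _).1 h0)
    (fun b hb => (hP _).1 (hs b ((hP b).2 hb))) a)

/-- Polynomial induction in a model of `S₂ⁱ` for a predicate `P : M → Prop` which is defined,
with parameters `p̄ ∈ Mᵏ`, by a `Σᵇᵢ` formula `φ(p̄, x)` (Buss 1986, §2.4).
[cite: Buss1986, §2.4] -/
theorem pinduction_S2 (hM : M ⊨ S2 i) {P : M → Prop}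
    (φ : Language.boundedArith.Formula (Fin (k + 1))) (hφ : IsSigmab i φ) (p : Fin k → M)
    (hP : ∀ a, P a ↔ φ.Realize (Fin.snoc p a)) (h0 : P (mZero M))
    (hs : ∀ a, P (mHalf a) → P a) (a : M) : P a :=
  (hP a).2 (pind_of_model_S2 hM hφ p ((hP _).1 h0)
    (fun b hb => (hP _).1 (hs b ((hP _).2 hb))) a)

end Models

/-! ## What the axioms of `BASIC` say in a structure -/

section BASICAxioms

variable {M : Type} [Language.boundedArith.Structure M]

/-- The `k`-th axiom of the list `basicAxioms` is an axiom of `BASIC`. [folklore] -/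
theorem getElem_mem_BASIC (k : ℕ) (hk : k < basicAxioms.length) : basicAxioms[k] ∈ BASIC :=
  List.getElem_mem hk

/-- In a model of `BASIC`: axiom (1) `y ≤ x → y ≤ Sx` (Buss 1986, §2.2). [cite: Buss1986, §2.2] -/
theorem basic_le_succ_of_le (h : M ⊨ BASIC) (x y : M) (hyx : MLe y x) :
    MLe y (mSucc x) := by
  have h1 := h.realize_of_mem _ (getElem_mem_BASIC 0 (by simp [length_basicAxioms]))
  change M ⊨ alls (n := 2) (Term.le &1 &0 ⟹ Term.le &1 (Term.succ &0)) at h1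
  simp only [Sentence.Realize, realize_alls, realize_imp, realize_le', realize_term_succ] at h1
  exact h1 ![x, y] hyx

/-- In a model of `BASIC`: axiom (2) `x ≠ Sx` (Buss 1986, §2.2). [cite: Buss1986, §2.2] -/
theorem basic_ne_succ_self (h : M ⊨ BASIC) (x : M) :
    x ≠ mSucc x := by
  have h1 := h.realize_of_mem _ (getElem_mem_BASIC 1 (by simp [length_basicAxioms]))
  change M ⊨ alls (n := 1) (∼(&0 =' Term.succ &0)) at h1
  simp only [Sentence.Realize, realize_alls, realize_not, realize_bdEqual, realize_term_succ] at h1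
  exact h1 ![x]

/-- In a model of `BASIC`: axiom (3) `0 ≤ x` (Buss 1986, §2.2). [cite: Buss1986, §2.2] -/
theorem basic_zero_le (h : M ⊨ BASIC) (x : M) :
    MLe (mZero M) x := by
  have h1 := h.realize_of_mem _ (getElem_mem_BASIC 2 (by simp [length_basicAxioms]))
  change M ⊨ alls (n := 1) (Term.le 0 &0) at h1
  simp only [Sentence.Realize, realize_alls, realize_le', realize_term_zero] at h1
  exact h1 ![x]

/-- In a model of `BASIC`: axiom (4) `(x ≤ y ∧ x ≠ y) ↔ Sx ≤ y`
(Buss 1986, §2.2). [cite: Buss1986, §2.2] -/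
theorem basic_le_and_ne_iff_succ_le (h : M ⊨ BASIC) (x y : M) :
    (MLe x y ∧ x ≠ y) ↔ MLe (mSucc x) y := by
  have h1 := h.realize_of_mem _ (getElem_mem_BASIC 3 (by simp [length_basicAxioms]))
  change M ⊨ alls (n := 2) ((Term.le &0 &1 ⊓ ∼(&0 =' &1)) ⇔ Term.le (Term.succ &0) &1) at h1
  simp only [Sentence.Realize, realize_alls, realize_iff, realize_inf, realize_not,
    realize_bdEqual, realize_le', realize_term_succ] at h1
  exact h1 ![x, y]

/-- In a model of `BASIC`: axiom (5) `x ≠ 0 → 2·x ≠ 0` (Buss 1986, §2.2). [cite: Buss1986, §2.2] -/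
theorem basic_two_mul_ne_zero (h : M ⊨ BASIC) (x : M) (hx : x ≠ mZero M) :
    mMul (mTwo M) x ≠ mZero M := by
  have h1 := h.realize_of_mem _ (getElem_mem_BASIC 4 (by simp [length_basicAxioms]))
  change M ⊨ alls (n := 1) (∼(&0 =' 0) ⟹ ∼((natConst 2 * &0) =' 0)) at h1
  simp only [Sentence.Realize, realize_alls, realize_not, realize_imp, realize_bdEqual,
    realize_term_mul, realize_term_zero, realize_natConst_two] at h1
  exact h1 ![x] hx

/-- In a model of `BASIC`: axiom (6) `y ≤ x ∨ x ≤ y` (Buss 1986, §2.2). [cite: Buss1986, §2.2] -/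
theorem basic_le_total (h : M ⊨ BASIC) (x y : M) :
    MLe y x ∨ MLe x y := by
  have h1 := h.realize_of_mem _ (getElem_mem_BASIC 5 (by simp [length_basicAxioms]))
  change M ⊨ alls (n := 2) (Term.le &1 &0 ⊔ Term.le &0 &1) at h1
  simp only [Sentence.Realize, realize_alls, realize_sup, realize_le'] at h1
  exact h1 ![x, y]

/-- In a model of `BASIC`: axiom (7) `x ≤ y ∧ y ≤ x → x = y`
(Buss 1986, §2.2). [cite: Buss1986, §2.2] -/
theorem basic_le_antisymm (h : M ⊨ BASIC) (x y : M) (hxy : MLe x y) (hyx : MLe y x) :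
    x = y := by
  have h1 := h.realize_of_mem _ (getElem_mem_BASIC 6 (by simp [length_basicAxioms]))
  change M ⊨ alls (n := 2) (Term.le &0 &1 ⊓ Term.le &1 &0 ⟹ (&0 =' &1)) at h1
  simp only [Sentence.Realize, realize_alls, realize_inf, realize_imp, realize_bdEqual,
    realize_le', and_imp] at h1
  exact h1 ![x, y] hxy hyx

/-- In a model of `BASIC`: axiom (8) `x ≤ y ∧ y ≤ z → x ≤ z`
(Buss 1986, §2.2). [cite: Buss1986, §2.2] -/
theorem basic_le_trans (h : M ⊨ BASIC) (x y z : M) (hxy : MLe x y) (hyz : MLe y z) :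
    MLe x z := by
  have h1 := h.realize_of_mem _ (getElem_mem_BASIC 7 (by simp [length_basicAxioms]))
  change M ⊨ alls (n := 3) (Term.le &0 &1 ⊓ Term.le &1 &2 ⟹ Term.le &0 &2) at h1
  simp only [Sentence.Realize, realize_alls, realize_inf, realize_imp, realize_le', and_imp] at h1
  exact h1 ![x, y, z] hxy hyz

/-- In a model of `BASIC`: axiom (9) `|0| = 0` (Buss 1986, §2.2). [cite: Buss1986, §2.2] -/
theorem basic_len_zero (h : M ⊨ BASIC) :
    mLen (mZero M) = mZero M := by
  have h1 := h.realize_of_mem _ (getElem_mem_BASIC 8 (by simp [length_basicAxioms]))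
  change M ⊨ alls (n := 0) (Term.len 0 =' 0) at h1
  simp only [Sentence.Realize, realize_alls, realize_bdEqual, realize_term_len,
    realize_term_zero] at h1
  exact h1 default

/-- In a model of `BASIC`: axiom (10) `x ≠ 0 → |2·x| = S|x| ∧ |S(2·x)| = S|x|`
(Buss 1986, §2.2). [cite: Buss1986, §2.2] -/
theorem basic_len_two_mul (h : M ⊨ BASIC) (x : M) (hx : x ≠ mZero M) :
    mLen (mMul (mTwo M) x) = mSucc (mLen x) ∧
      mLen (mSucc (mMul (mTwo M) x)) = mSucc (mLen x) := by
  have h1 := h.realize_of_mem _ (getElem_mem_BASIC 9 (by simp [length_basicAxioms]))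
  change M ⊨ alls (n := 1) (∼(&0 =' 0) ⟹
      ((Term.len (natConst 2 * &0) =' Term.succ (Term.len &0)) ⊓
        (Term.len (Term.succ (natConst 2 * &0)) =' Term.succ (Term.len &0)))) at h1
  simp only [Sentence.Realize, realize_alls, realize_inf, realize_not, realize_imp,
    realize_bdEqual, realize_term_succ, realize_term_len, realize_term_mul, realize_term_zero,
    realize_natConst_two] at h1
  exact h1 ![x] hx

/-- In a model of `BASIC`: axiom (11) `|S0| = S0` (Buss 1986, §2.2). [cite: Buss1986, §2.2] -/
theorem basic_len_one (h : M ⊨ BASIC) :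
    mLen (mOne M) = mOne M := by
  have h1 := h.realize_of_mem _ (getElem_mem_BASIC 10 (by simp [length_basicAxioms]))
  change M ⊨ alls (n := 0) (Term.len (natConst 1) =' natConst 1) at h1
  simp only [Sentence.Realize, realize_alls, realize_bdEqual, realize_term_len,
    realize_natConst_one] at h1
  exact h1 default

/-- In a model of `BASIC`: axiom (12) `x ≤ y → |x| ≤ |y|`
(Buss 1986, §2.2). [cite: Buss1986, §2.2] -/
theorem basic_len_le_len (h : M ⊨ BASIC) (x y : M) (hxy : MLe x y) :
    MLe (mLen x) (mLen y) := by
  have h1 := h.realize_of_mem _ (getElem_mem_BASIC 11 (by simp [length_basicAxioms]))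
  change M ⊨ alls (n := 2) (Term.le &0 &1 ⟹ Term.le (Term.len &0) (Term.len &1)) at h1
  simp only [Sentence.Realize, realize_alls, realize_imp, realize_le', realize_term_len] at h1
  exact h1 ![x, y] hxy

/-- In a model of `BASIC`: axiom (13) `|x # y| = S(|x|·|y|)`
(Buss 1986, §2.2). [cite: Buss1986, §2.2] -/
theorem basic_len_smash (h : M ⊨ BASIC) (x y : M) :
    mLen (mSmash x y) = mSucc (mMul (mLen x) (mLen y)) := by
  have h1 := h.realize_of_mem _ (getElem_mem_BASIC 12 (by simp [length_basicAxioms]))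
  change M ⊨ alls (n := 2) (Term.len (Term.smash &0 &1) =' Term.succ (Term.len &0 * Term.len &1))
    at h1
  simp only [Sentence.Realize, realize_alls, realize_bdEqual, realize_term_succ, realize_term_len,
    realize_term_mul, realize_term_smash] at h1
  exact h1 ![x, y]

/-- In a model of `BASIC`: axiom (14) `0 # y = S0` (Buss 1986, §2.2). [cite: Buss1986, §2.2] -/
theorem basic_zero_smash (h : M ⊨ BASIC) (y : M) :
    mSmash (mZero M) y = mOne M := by
  have h1 := h.realize_of_mem _ (getElem_mem_BASIC 13 (by simp [length_basicAxioms]))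
  change M ⊨ alls (n := 1) (Term.smash 0 &0 =' natConst 1) at h1
  simp only [Sentence.Realize, realize_alls, realize_bdEqual, realize_term_smash,
    realize_term_zero, realize_natConst_one] at h1
  exact h1 ![y]

/-- In a model of `BASIC`: axiom (15) `x ≠ 0 → 1 # (2·x) = 2·(1 # x) ∧ 1 # S(2·x) = 2·(1 # x)`
(Buss 1986, §2.2). [cite: Buss1986, §2.2] -/
theorem basic_one_smash_two_mul (h : M ⊨ BASIC) (x : M) (hx : x ≠ mZero M) :
    mSmash (mOne M) (mMul (mTwo M) x) = mMul (mTwo M) (mSmash (mOne M) x) ∧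
      mSmash (mOne M) (mSucc (mMul (mTwo M) x)) = mMul (mTwo M) (mSmash (mOne M) x) := by
  have h1 := h.realize_of_mem _ (getElem_mem_BASIC 14 (by simp [length_basicAxioms]))
  change M ⊨ alls (n := 1) (∼(&0 =' 0) ⟹
      ((Term.smash (natConst 1) (natConst 2 * &0) =' (natConst 2 * Term.smash (natConst 1) &0)) ⊓
        (Term.smash (natConst 1) (Term.succ (natConst 2 * &0)) ='
          (natConst 2 * Term.smash (natConst 1) &0)))) at h1
  simp only [Sentence.Realize, realize_alls, realize_inf, realize_not, realize_imp,
    realize_bdEqual, realize_term_succ, realize_term_mul, realize_term_smash, realize_term_zero,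
    realize_natConst_one, realize_natConst_two] at h1
  exact h1 ![x] hx

/-- In a model of `BASIC`: axiom (16) `x # y = y # x` (Buss 1986, §2.2). [cite: Buss1986, §2.2] -/
theorem basic_smash_comm (h : M ⊨ BASIC) (x y : M) :
    mSmash x y = mSmash y x := by
  have h1 := h.realize_of_mem _ (getElem_mem_BASIC 15 (by simp [length_basicAxioms]))
  change M ⊨ alls (n := 2) (Term.smash &0 &1 =' Term.smash &1 &0) at h1
  simp only [Sentence.Realize, realize_alls, realize_bdEqual, realize_term_smash] at h1
  exact h1 ![x, y]

/-- In a model of `BASIC`: axiom (17) `|x| = |y| → x # z = y # z`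
(Buss 1986, §2.2). [cite: Buss1986, §2.2] -/
theorem basic_smash_eq_smash_of_len_eq (h : M ⊨ BASIC) (x y z : M) (hxy : mLen x = mLen y) :
    mSmash x z = mSmash y z := by
  have h1 := h.realize_of_mem _ (getElem_mem_BASIC 16 (by simp [length_basicAxioms]))
  change M ⊨ alls (n := 3) ((Term.len &0 =' Term.len &1) ⟹ (Term.smash &0 &2 =' Term.smash &1 &2))
    at h1
  simp only [Sentence.Realize, realize_alls, realize_imp, realize_bdEqual, realize_term_len,
    realize_term_smash] at h1
  exact h1 ![x, y, z] hxy

/-- In a model of `BASIC`: axiom (18) `|x| = |u| + |v| → x # y = (u # y)·(v # y)`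
(Buss 1986, §2.2). [cite: Buss1986, §2.2] -/
theorem basic_smash_eq_mul_smash_of_len_eq_add (h : M ⊨ BASIC)
    (x y u v : M) (hx : mLen x = mAdd (mLen u) (mLen v)) :
    mSmash x y = mMul (mSmash u y) (mSmash v y) := by
  have h1 := h.realize_of_mem _ (getElem_mem_BASIC 17 (by simp [length_basicAxioms]))
  change M ⊨ alls (n := 4) ((Term.len &0 =' (Term.len &2 + Term.len &3)) ⟹
      (Term.smash &0 &1 =' (Term.smash &2 &1 * Term.smash &3 &1))) at h1
  simp only [Sentence.Realize, realize_alls, realize_imp, realize_bdEqual, realize_term_len,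
    realize_term_add, realize_term_mul, realize_term_smash] at h1
  exact h1 ![x, y, u, v] hx

/-- In a model of `BASIC`: axiom (19) `x ≤ x + y` (Buss 1986, §2.2). [cite: Buss1986, §2.2] -/
theorem basic_le_add_right (h : M ⊨ BASIC) (x y : M) :
    MLe x (mAdd x y) := by
  have h1 := h.realize_of_mem _ (getElem_mem_BASIC 18 (by simp [length_basicAxioms]))
  change M ⊨ alls (n := 2) (Term.le &0 (&0 + &1)) at h1
  simp only [Sentence.Realize, realize_alls, realize_le', realize_term_add] at h1
  exact h1 ![x, y]

/-- In a model of `BASIC`: axiom (20) `x ≤ y ∧ x ≠ y → S(2·x) ≤ 2·y ∧ S(2·x) ≠ 2·y`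
(Buss 1986, §2.2). [cite: Buss1986, §2.2] -/
theorem basic_succ_two_mul_lt_two_mul (h : M ⊨ BASIC) (x y : M) (hxy : MLe x y) (hne : x ≠ y) :
    MLe (mSucc (mMul (mTwo M) x)) (mMul (mTwo M) y) ∧
      mSucc (mMul (mTwo M) x) ≠ mMul (mTwo M) y := by
  have h1 := h.realize_of_mem _ (getElem_mem_BASIC 19 (by simp [length_basicAxioms]))
  change M ⊨ alls (n := 2) (Term.le &0 &1 ⊓ ∼(&0 =' &1) ⟹
      (Term.le (Term.succ (natConst 2 * &0)) (natConst 2 * &1) ⊓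
        ∼(Term.succ (natConst 2 * &0) =' (natConst 2 * &1)))) at h1
  simp only [Sentence.Realize, realize_alls, realize_inf, realize_not, realize_imp,
    realize_bdEqual, realize_le', realize_term_succ, realize_term_mul, realize_natConst_two,
    and_imp] at h1
  exact h1 ![x, y] hxy hne

/-- In a model of `BASIC`: axiom (21) `x + y = y + x` (Buss 1986, §2.2). [cite: Buss1986, §2.2] -/
theorem basic_add_comm (h : M ⊨ BASIC) (x y : M) :
    mAdd x y = mAdd y x := by
  have h1 := h.realize_of_mem _ (getElem_mem_BASIC 20 (by simp [length_basicAxioms]))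
  change M ⊨ alls (n := 2) ((&0 + &1) =' (&1 + &0)) at h1
  simp only [Sentence.Realize, realize_alls, realize_bdEqual, realize_term_add] at h1
  exact h1 ![x, y]

/-- In a model of `BASIC`: axiom (22) `x + 0 = x` (Buss 1986, §2.2). [cite: Buss1986, §2.2] -/
theorem basic_add_zero (h : M ⊨ BASIC) (x : M) :
    mAdd x (mZero M) = x := by
  have h1 := h.realize_of_mem _ (getElem_mem_BASIC 21 (by simp [length_basicAxioms]))
  change M ⊨ alls (n := 1) ((&0 + 0) =' &0) at h1
  simp only [Sentence.Realize, realize_alls, realize_bdEqual, realize_term_add,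
    realize_term_zero] at h1
  exact h1 ![x]

/-- In a model of `BASIC`: axiom (23) `x + Sy = S(x + y)`
(Buss 1986, §2.2). [cite: Buss1986, §2.2] -/
theorem basic_add_succ (h : M ⊨ BASIC) (x y : M) :
    mAdd x (mSucc y) = mSucc (mAdd x y) := by
  have h1 := h.realize_of_mem _ (getElem_mem_BASIC 22 (by simp [length_basicAxioms]))
  change M ⊨ alls (n := 2) ((&0 + Term.succ &1) =' Term.succ (&0 + &1)) at h1
  simp only [Sentence.Realize, realize_alls, realize_bdEqual, realize_term_succ,
    realize_term_add] at h1
  exact h1 ![x, y]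

/-- In a model of `BASIC`: axiom (24) `(x + y) + z = x + (y + z)`
(Buss 1986, §2.2). [cite: Buss1986, §2.2] -/
theorem basic_add_assoc (h : M ⊨ BASIC) (x y z : M) :
    mAdd (mAdd x y) z = mAdd x (mAdd y z) := by
  have h1 := h.realize_of_mem _ (getElem_mem_BASIC 23 (by simp [length_basicAxioms]))
  change M ⊨ alls (n := 3) ((&0 + &1 + &2) =' (&0 + (&1 + &2))) at h1
  simp only [Sentence.Realize, realize_alls, realize_bdEqual, realize_term_add] at h1
  exact h1 ![x, y, z]

/-- In a model of `BASIC`: axiom (25) `x + y ≤ x + z ↔ y ≤ z`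
(Buss 1986, §2.2). [cite: Buss1986, §2.2] -/
theorem basic_add_le_add_iff_left (h : M ⊨ BASIC) (x y z : M) :
    MLe (mAdd x y) (mAdd x z) ↔ MLe y z := by
  have h1 := h.realize_of_mem _ (getElem_mem_BASIC 24 (by simp [length_basicAxioms]))
  change M ⊨ alls (n := 3) (Term.le (&0 + &1) (&0 + &2) ⇔ Term.le &1 &2) at h1
  simp only [Sentence.Realize, realize_alls, realize_iff, realize_le', realize_term_add] at h1
  exact h1 ![x, y, z]

/-- In a model of `BASIC`: axiom (26) `x·0 = 0` (Buss 1986, §2.2). [cite: Buss1986, §2.2] -/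
theorem basic_mul_zero (h : M ⊨ BASIC) (x : M) :
    mMul x (mZero M) = mZero M := by
  have h1 := h.realize_of_mem _ (getElem_mem_BASIC 25 (by simp [length_basicAxioms]))
  change M ⊨ alls (n := 1) ((&0 * 0) =' 0) at h1
  simp only [Sentence.Realize, realize_alls, realize_bdEqual, realize_term_mul,
    realize_term_zero] at h1
  exact h1 ![x]

/-- In a model of `BASIC`: axiom (27) `x·Sy = x·y + x` (Buss 1986, §2.2). [cite: Buss1986, §2.2] -/
theorem basic_mul_succ (h : M ⊨ BASIC) (x y : M) :
    mMul x (mSucc y) = mAdd (mMul x y) x := by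
  have h1 := h.realize_of_mem _ (getElem_mem_BASIC 26 (by simp [length_basicAxioms]))
  change M ⊨ alls (n := 2) ((&0 * Term.succ &1) =' (&0 * &1 + &0)) at h1
  simp only [Sentence.Realize, realize_alls, realize_bdEqual, realize_term_succ, realize_term_add,
    realize_term_mul] at h1
  exact h1 ![x, y]

/-- In a model of `BASIC`: axiom (28) `x·y = y·x` (Buss 1986, §2.2). [cite: Buss1986, §2.2] -/
theorem basic_mul_comm (h : M ⊨ BASIC) (x y : M) :
    mMul x y = mMul y x := by
  have h1 := h.realize_of_mem _ (getElem_mem_BASIC 27 (by simp [length_basicAxioms]))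
  change M ⊨ alls (n := 2) ((&0 * &1) =' (&1 * &0)) at h1
  simp only [Sentence.Realize, realize_alls, realize_bdEqual, realize_term_mul] at h1
  exact h1 ![x, y]

/-- In a model of `BASIC`: axiom (29) `x·(y + z) = x·y + x·z`
(Buss 1986, §2.2). [cite: Buss1986, §2.2] -/
theorem basic_mul_add (h : M ⊨ BASIC) (x y z : M) :
    mMul x (mAdd y z) = mAdd (mMul x y) (mMul x z) := by
  have h1 := h.realize_of_mem _ (getElem_mem_BASIC 28 (by simp [length_basicAxioms]))
  change M ⊨ alls (n := 3) ((&0 * (&1 + &2)) =' (&0 * &1 + &0 * &2)) at h1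
  simp only [Sentence.Realize, realize_alls, realize_bdEqual, realize_term_add,
    realize_term_mul] at h1
  exact h1 ![x, y, z]

/-- In a model of `BASIC`: axiom (30) `S0 ≤ x → (x·y ≤ x·z ↔ y ≤ z)`
(Buss 1986, §2.2). [cite: Buss1986, §2.2] -/
theorem basic_mul_le_mul_iff_left (h : M ⊨ BASIC) (x y z : M) (hx : MLe (mOne M) x) :
    MLe (mMul x y) (mMul x z) ↔ MLe y z := by
  have h1 := h.realize_of_mem _ (getElem_mem_BASIC 29 (by simp [length_basicAxioms]))
  change M ⊨ alls (n := 3) (Term.le (natConst 1) &0 ⟹ (Term.le (&0 * &1) (&0 * &2) ⇔ Term.le &1 &2))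
    at h1
  simp only [Sentence.Realize, realize_alls, realize_iff, realize_imp, realize_le',
    realize_term_mul, realize_natConst_one] at h1
  exact h1 ![x, y, z] hx

/-- In a model of `BASIC`: axiom (31) `x ≠ 0 → |x| = S|⌊x/2⌋|`
(Buss 1986, §2.2). [cite: Buss1986, §2.2] -/
theorem basic_len_eq_succ_len_half (h : M ⊨ BASIC) (x : M) (hx : x ≠ mZero M) :
    mLen x = mSucc (mLen (mHalf x)) := by
  have h1 := h.realize_of_mem _ (getElem_mem_BASIC 30 (by simp [length_basicAxioms]))
  change M ⊨ alls (n := 1) (∼(&0 =' 0) ⟹ (Term.len &0 =' Term.succ (Term.len (Term.half &0)))) at h1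
  simp only [Sentence.Realize, realize_alls, realize_not, realize_imp, realize_bdEqual,
    realize_term_succ, realize_term_half, realize_term_len, realize_term_zero] at h1
  exact h1 ![x] hx

/-- In a model of `BASIC`: axiom (32) `x = ⌊y/2⌋ ↔ (2·x = y ∨ S(2·x) = y)`
(Buss 1986, §2.2). [cite: Buss1986, §2.2] -/
theorem basic_eq_half_iff (h : M ⊨ BASIC) (x y : M) :
    x = mHalf y ↔ (mMul (mTwo M) x = y ∨ mSucc (mMul (mTwo M) x) = y) := by
  have h1 := h.realize_of_mem _ (getElem_mem_BASIC 31 (by simp [length_basicAxioms]))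
  change M ⊨ alls (n := 2) ((&0 =' Term.half &1) ⇔
      (((natConst 2 * &0) =' &1) ⊔ (Term.succ (natConst 2 * &0) =' &1))) at h1
  simp only [Sentence.Realize, realize_alls, realize_iff, realize_sup, realize_bdEqual,
    realize_term_succ, realize_term_half, realize_term_mul, realize_natConst_two] at h1
  exact h1 ![x, y]

end BASICAxioms

end Literature.Computability.MetaComplexity
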